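import Literature.Probability.LatticeModels.MTP2Tilt
import HarnessLib

/-!
# Products of density-free MTP₂ laws are MTP₂

Colangelo–Müller–Scarsini list, among the properties of the class `P⁺_{d,MTP₂}` of density-free MTP₂ laws
(Definition 2 = `mIsSetTP2`), **B3**: `J_d ⊆ P⁺_{d,MTP₂}` — laws with independent (real) coordinates are MTP₂
(tree: `mIsSetTP2_pi`).  [cite: ColangeloMullerScarsini2006, Thm. 3 (B3)]  For densities, "the direct product of
MTP₂ densities is MTP₂" is a case of "products of MTP₂ functions are MTP₂" [cite: KarlinRinott1980, (1.14)].

This file proves the general **measure-level product property** on Euclidean configuration spaces: if `µ` is a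
finite MTP₂ measure on `ℝ^{ι₁}` and `ν` a finite MTP₂ measure on `ℝ^{ι₂}` (no densities), then

* `mIsSetTP2.sumPi_prod` — the joint law of the independent coupling, realised on `ℝ^{ι₁ ⊕ ι₂}`, is MTP₂;
* `mIsSetTP2.prod` — equivalently `µ.prod ν` is MTP₂ on the product lattice `ℝ^{ι₁} × ℝ^{ι₂}`.

Proof: by CMS Theorem 1 (a) ⟺ (c′) (`mIsSetTP2_iff_cmsCondC'`) it suffices to check inequality (2) on closed
boxes of `ℝ^{ι₁ ⊕ ι₂}`; a box there is a product of boxes, meets and joins of corners are computed blockwise, so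
the inequality is the product of the two box inequalities.  (Not stated in this generality in
[ColangeloMullerScarsini2006]; it is the obvious common generalisation of B3 and of the density statement, and —
like the tilt property of `MTP2Tilt.lean` — also follows from Thm. 1 (a) ⇒ (e) and Thm. 2 there.)
Combined with `MTP2Tilt.lean` (`mIsSetTP2.sumPi_prod_withDensity`): a continuous bounded log-supermodular coupling
`ρ(x,y) µ(dx) ν(dy)` of two MTP₂ systems is MTP₂.
-/

noncomputable section

namespace Literature.Probability.LatticeModels.Affiliation

open MeasureTheory Set
open scoped ENNReal

variable {ι₁ ι₂ : Type*}

/-- A closed box of `ℝ^{ι₁ ⊕ ι₂}` is the product of its two block boxes.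
[cite: ColangeloMullerScarsini2006, Thm. 3 (B3) (setting)] -/
theorem preimage_blockEquiv_symm_Icc (a b : ι₁ ⊕ ι₂ → ℝ) :
    (MeasurableEquiv.sumPiEquivProdPi fun _ : ι₁ ⊕ ι₂ => ℝ).symm ⁻¹' Icc a b =
      Icc (fun i => a (Sum.inl i)) (fun i => b (Sum.inl i)) ×ˢ
        Icc (fun i => a (Sum.inr i)) (fun i => b (Sum.inr i)) := by
  ext ⟨x, y⟩
  simp only [mem_preimage, MeasurableEquiv.coe_sumPiEquivProdPi_symm, mem_Icc, Pi.le_def, Sum.forall,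
    Equiv.sumPiEquivProdPi_symm_apply, mem_prod]
  tauto

/-- **Products of density-free MTP₂ laws are MTP₂ (on `ℝ^{ι₁ ⊕ ι₂}`)**: for finite MTP₂ measures `µ` on `ℝ^{ι₁}`
and `ν` on `ℝ^{ι₂}`, the independent joint law `(µ ⊗ ν) ∘ (blocks)⁻¹` on `ℝ^{ι₁ ⊕ ι₂}` is MTP₂ (Definition 2).
The common generalisation of B3 (independent coordinates) and of "direct products of MTP₂ densities are MTP₂".
[cite: ColangeloMullerScarsini2006, Thm. 3 (B3) and Thm. 1 (a) ⟺ (c′); KarlinRinott1980, (1.14)] -/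
theorem mIsSetTP2.sumPi_prod [Fintype ι₁] [Fintype ι₂] {μ : Measure (ι₁ → ℝ)} {ν : Measure (ι₂ → ℝ)}
    [IsFiniteMeasure μ] [IsFiniteMeasure ν] (hμ : mIsSetTP2 μ) (hν : mIsSetTP2 ν) :
    mIsSetTP2 ((μ.prod ν).map (MeasurableEquiv.sumPiEquivProdPi fun _ : ι₁ ⊕ ι₂ => ℝ).symm) := by
  set e := (MeasurableEquiv.sumPiEquivProdPi fun _ : ι₁ ⊕ ι₂ => ℝ) with he
  haveI : IsFiniteMeasure ((μ.prod ν).map e.symm) := Measure.isFiniteMeasure_map _ _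
  rw [mIsSetTP2_iff_cmsCondC']
  intro a b a' b'
  have hbox : ∀ a b : ι₁ ⊕ ι₂ → ℝ, ((μ.prod ν).map e.symm) (Icc a b) =
      μ (Icc (fun i => a (Sum.inl i)) (fun i => b (Sum.inl i))) *
        ν (Icc (fun i => a (Sum.inr i)) (fun i => b (Sum.inr i))) := fun a b => by
    rw [MeasurableEquiv.map_apply, he, preimage_blockEquiv_symm_Icc, Measure.prod_prod]
  rw [hbox, hbox, hbox, hbox]
  have h1 := hμ.cmsCondC' (fun i => a (Sum.inl i)) (fun i => b (Sum.inl i)) (fun i => a' (Sum.inl i))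
    (fun i => b' (Sum.inl i))
  have h2 := hν.cmsCondC' (fun i => a (Sum.inr i)) (fun i => b (Sum.inr i)) (fun i => a' (Sum.inr i))
    (fun i => b' (Sum.inr i))
  calc μ (Icc (fun i => a (Sum.inl i)) fun i => b (Sum.inl i)) * ν (Icc (fun i => a (Sum.inr i)) fun i => b (Sum.inr i)) *
        (μ (Icc (fun i => a' (Sum.inl i)) fun i => b' (Sum.inl i)) *
          ν (Icc (fun i => a' (Sum.inr i)) fun i => b' (Sum.inr i)))
      = (μ (Icc (fun i => a (Sum.inl i)) fun i => b (Sum.inl i)) *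
          μ (Icc (fun i => a' (Sum.inl i)) fun i => b' (Sum.inl i))) *
        (ν (Icc (fun i => a (Sum.inr i)) fun i => b (Sum.inr i)) *
          ν (Icc (fun i => a' (Sum.inr i)) fun i => b' (Sum.inr i))) := by ring
    _ ≤ (μ (Icc ((fun i => a (Sum.inl i)) ⊓ fun i => a' (Sum.inl i)) ((fun i => b (Sum.inl i)) ⊓ fun i => b' (Sum.inl i))) *
          μ (Icc ((fun i => a (Sum.inl i)) ⊔ fun i => a' (Sum.inl i)) ((fun i => b (Sum.inl i)) ⊔ fun i => b' (Sum.inl i)))) *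
        (ν (Icc ((fun i => a (Sum.inr i)) ⊓ fun i => a' (Sum.inr i)) ((fun i => b (Sum.inr i)) ⊓ fun i => b' (Sum.inr i))) *
          ν (Icc ((fun i => a (Sum.inr i)) ⊔ fun i => a' (Sum.inr i)) ((fun i => b (Sum.inr i)) ⊔ fun i => b' (Sum.inr i)))) :=
        mul_le_mul' h1 h2
    _ = _ := by
        simp only [Pi.inf_def, Pi.sup_def]
        ring

/-- **`µ.prod ν` is MTP₂ on the product lattice `ℝ^{ι₁} × ℝ^{ι₂}`** for finite density-free MTP₂ `µ, ν`
(transport of `mIsSetTP2.sumPi_prod` along the lattice isomorphism "blocks").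
[cite: ColangeloMullerScarsini2006, Thm. 3 (B3) and Thm. 1; KarlinRinott1980, (1.14)] -/
theorem mIsSetTP2.prod [Fintype ι₁] [Fintype ι₂] {μ : Measure (ι₁ → ℝ)} {ν : Measure (ι₂ → ℝ)}
    [IsFiniteMeasure μ] [IsFiniteMeasure ν] (hμ : mIsSetTP2 μ) (hν : mIsSetTP2 ν) :
    mIsSetTP2 (μ.prod ν) := by
  set e := (MeasurableEquiv.sumPiEquivProdPi fun _ : ι₁ ⊕ ι₂ => ℝ) with he
  have h := (hμ.sumPi_prod hν).map_of_map_sup_inf e.measurable (fun x y => ?_) (fun x y => ?_)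
  · rwa [Measure.map_map e.measurable e.symm.measurable, MeasurableEquiv.self_comp_symm, Measure.map_id] at h
  · rfl
  · rfl

/-- **Coupled systems**: a continuous bounded log-supermodular coupling `ρ(x,y) µ(dx) ν(dy)` of two finite
density-free MTP₂ laws (realised on `ℝ^{ι₁ ⊕ ι₂}`) is MTP₂ — in particular the Gibbs coupling `e^{-H(x,y)} µ ⊗ ν` with
`H` continuous submodular bounded below (`mIsSetTP2.withDensity_exp_neg`).  Product step: this file; tilt step:
`MTP2Tilt.lean`.  [cite: KarlinRinott1980, (1.14) (density case); ColangeloMullerScarsini2006, Thm. 3 (B3) and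
Thms. 1–2 (corollary; not stated there)] -/
theorem mIsSetTP2.sumPi_prod_withDensity [Fintype ι₁] [Fintype ι₂] {μ : Measure (ι₁ → ℝ)}
    {ν : Measure (ι₂ → ℝ)} [IsFiniteMeasure μ] [IsFiniteMeasure ν] (hμ : mIsSetTP2 μ) (hν : mIsSetTP2 ν)
    {ρ : (ι₁ ⊕ ι₂ → ℝ) → NNReal} (hρc : Continuous ρ) (hρ : ∀ x y, ρ x * ρ y ≤ ρ (x ⊓ y) * ρ (x ⊔ y))
    {C : NNReal} (hC : ∀ x, ρ x ≤ C) :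
    mIsSetTP2 ((((μ.prod ν).map (MeasurableEquiv.sumPiEquivProdPi fun _ : ι₁ ⊕ ι₂ => ℝ).symm)).withDensity
      fun z => (ρ z : ℝ≥0∞)) := by
  haveI : IsFiniteMeasure ((μ.prod ν).map (MeasurableEquiv.sumPiEquivProdPi fun _ : ι₁ ⊕ ι₂ => ℝ).symm) :=
    Measure.isFiniteMeasure_map _ _
  exact (hμ.sumPi_prod hν).withDensity_of_continuous hρc hρ hC

end Literature.Probability.LatticeModels.Affiliation
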